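import Literature.NumberTheory.GelbartRogawski1991.LocalSplittingCMRationalSimilitudeRigidity
import Literature.RepresentationTheory.HeisenbergGroup.SchrodingerSymplecticGenerators
import HarnessLib

/-!
# The undoubled CM splitting under a RATIONAL SIMILITUDE: `ω(s_χ(k g k⁻¹)) = R_k ∘ ω(scaleTransport_{m₀}(s′_χ)(g)) ∘ R_k⁻¹`

Topic `NumberTheory/GelbartRogawski1991`; namespace `Literature.NumberTheory.GelbartRogawski1991.UnitaryDualPair.LocalSplitting`.  KERNEL ONLY: theorems; no definition,
no named fact, no `sorry`.  Cell `hodgecm-mathlib` (D-0151), programme P5 (crux HLiu418 = stmt-HodgeConjecture-24832), piece **P3u** of the road card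
`F0/P5/A-p18/g23/ROAD-L4if-v2.A-p18g23.md` §4 (A-p18 (g23), 2026-08-31): the UNDOUBLED, REPRESENTATION-LEVEL reading of ★ P3c
`localSplittingDatumCM_localCongr_kd_eq_scaleTransportSection` — step (M3) «`θ_{λ,a}^{Ad k} ≅ θ_{λ,m₀a}`» of the in-house road for Liu's Lemma D.1 (4) «if».

SETTING: CM field `L`, `T₀` diagonal invertible over `L⁺`, `k₀ ∈ GL_n(L⁺)` with `ᵗk₀ T₀ k₀ = m₀ T₀`, `T₀′ = m₀ T₀`, `k = k₀ ⊗ 1`, `KD = (k₀ ⊕ k₀) ⊗ 1`, a splitting Hecke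
character `χ`, a finite place `v` of `L⁺`.
* §1 **the CANONICAL lift `P̃ = (m(K, m₀⁻¹K), L_K) ∈ S̃p_ψ(𝕎^𝔻_v)` of the see-saw element `P = Res(KD_v) ∘ e′_{m₀}⁻¹`** (★ `levi_mem_MpPsi`: the Levi pair of
  [MoeglinVignerasWaldspurger1987, Chap. 2 II.6]; `leviSp_kd_coe` identifies its projection with `P` of ★ P3b); its operator `L_K : Φ ↦ Φ ∘ K⁻¹` on `𝒮(L⁺_v^{n+n})`
  is `⊠`-DECOMPOSABLE: `L_K(φ₁ ⊠ φ₂) = L_k φ₁ ⊠ L_k φ₂` (`leviEquivSB_kd_boxSB`), and `L_K⁻¹ = L_{K⁻¹}` (`leviEquivSB_glEquiv_symm`).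
* §2 **`toRep_localSplittingCMWith_localCongr_k`**: for every `g ∈ U(T₀)(L⁺_v)` and `Φ ∈ 𝒮(L⁺_vⁿ)`,
  `ω(s_χ(k g k⁻¹)) Φ = L_k (ω(scaleTransportSection_{m₀}(s′_χ)(g)) (L_k⁻¹ Φ))` — restrict ★ P3c to `g ⊕ 1` (★ P3a `localCongr_kd_inlLoc`), strip the second factor
  (★ `toRep_undoubleLoc_boxSB`, ★ `boxSB_left_cancel`; `s_χ = undoubleLoc Σ_χ` by definition, ★ `scaleTransportSection_localSplittingCMWith`).
  In the road's words: **`θ^{T₀}_χ ∘ Ad(k) ≅ θ^{T₀}_χ` read on the line `m₀`** — intertwined by the Levi operator `L_k`, no character left over.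
Nothing of the cited sources is asserted; HC_CM is proved only modulo the printed citations until rung 0 closes.

## References
* [MoeglinVignerasWaldspurger1987] LNM 1291 (1987), Chap. 2 II.1 Rem. (6), II.6; Chap. 3 I.1–I.3.
* [Kudla1994] S. Kudla, Israel J. Math. 87 (1994), §3 Thm. 3.1.
* [GelbartRogawski1991] S. Gelbart, J. Rogawski, Invent. Math. 105 (1991), §3.1 Prop. 3.1.1 p. 455 L1–3, Remark p. 457.
* [Weil1964] A. Weil, Acta Math. 111 (1964), n° 13 p. 160 (the operators `d₀(α)`).
-/

set_option autoImplicit false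
-- buildfix G11b-3 recipe (LEDGER B13-1/B13-3), as in the GelbartRogawski1991 siblings: elaborate sequentially.
set_option Elab.async false

noncomputable section

open scoped Matrix
open NumberField IsDedekindDomain MeasureTheory Matrix
open Literature.RepresentationTheory.HeisenbergGroup Literature.RepresentationTheory.HeisenbergGroup.SymplecticMatrix
open Literature.NumberTheory.Automorphic Literature.NumberTheory.Automorphic.UnitaryGroup Literature.NumberTheory.Weil1964
open Literature.NumberTheory.GaloisRepresentations Literature.RepresentationTheory.HarrisKudlaSweet1996

namespace Literature.NumberTheory.GelbartRogawski1991.UnitaryDualPair.LocalSplitting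

/-! ## §1 The Levi lift of the see-saw element and its `⊠`-decomposable operator -/

section Levi

variable (F : Type) [Field F] [NumberField F] (v : HeightOneSpectrum (𝓞 F)) (n : ℕ)

/-- a linear automorphism of `F_v^N` is continuous. [folklore] -/
private theorem continuous_linearEquiv {N : ℕ} (a : (Fin N → v.adicCompletion F) ≃ₗ[v.adicCompletion F] (Fin N → v.adicCompletion F)) :
    Continuous a :=
  (a : (Fin N → v.adicCompletion F) →ₗ[v.adicCompletion F] (Fin N → v.adicCompletion F)).continuous_on_pi

/-- a vector on `Fin (n + n)` is `Sum.elim` of its halves, read through `e₂`. [folklore] -/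
private theorem comp_e₂_eq_sum_elim' (x : Fin (n + n) → v.adicCompletion F) : x ∘ (e₂ n) = Sum.elim (halfL F v n x) (halfR F v n x) := by
  funext s; rcases s with i | i <;> rfl

/-- `(reindex e₂ e₂ (A ⊕ A)) x` has halves `A x_L`, `A x_R`. [folklore] -/
private theorem halves_reindex_fromBlocks_mulVec' (A : Matrix (Fin n) (Fin n) (v.adicCompletion F)) (x : Fin (n + n) → v.adicCompletion F) :
    halfL F v n (Matrix.reindex (e₂ n) (e₂ n) (Matrix.fromBlocks A 0 0 A) *ᵥ x) = A *ᵥ halfL F v n x ∧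
      halfR F v n (Matrix.reindex (e₂ n) (e₂ n) (Matrix.fromBlocks A 0 0 A) *ᵥ x) = A *ᵥ halfR F v n x := by
  rw [Matrix.reindex_apply, Matrix.submatrix_mulVec_equiv, Equiv.symm_symm, comp_e₂_eq_sum_elim', Matrix.fromBlocks_mulVec]
  simp only [Matrix.zero_mulVec, add_zero, zero_add]
  exact ⟨funext fun i => by simp only [halfL, Function.comp_apply, Equiv.symm_apply_apply, Sum.elim_inl, Sum.elim_comp_inl],
    funext fun i => by simp only [halfR, Function.comp_apply, Equiv.symm_apply_apply, Sum.elim_inr, Sum.elim_comp_inr]⟩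

/-- **`L_a⁻¹ = L_{a⁻¹}`** for the Levi operators on `𝒮(F_v^N)`. [cite: Weil1964, n° 13 p. 160] -/
theorem leviEquivSB_glEquiv_symm {N : ℕ} (a : GL (Fin N) (v.adicCompletion F)) (Φ : SchwartzBruhat (Fin N → v.adicCompletion F)) :
    (leviEquivSB (glEquiv a) (continuous_linearEquiv F v (glEquiv a)) (continuous_linearEquiv F v (glEquiv a).symm)).symm Φ =
      leviEquivSB (glEquiv a⁻¹) (continuous_linearEquiv F v (glEquiv a⁻¹)) (continuous_linearEquiv F v (glEquiv a⁻¹).symm) Φ := by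
  rw [LinearEquiv.symm_apply_eq]
  apply Subtype.ext
  funext u
  rw [coe_leviEquivSB, leviOp_apply, coe_leviEquivSB, leviOp_apply, glEquiv_symm_apply, glEquiv_symm_apply, inv_inv, Matrix.mulVec_mulVec,
    ← Units.val_mul, mul_inv_cancel, Units.val_one, Matrix.one_mulVec]

/-- **`L_{k ⊕ k}(φ₁ ⊠ φ₂) = L_k φ₁ ⊠ L_k φ₂`**: the Levi operator of a block-diagonal-doubled matrix is `⊠`-decomposable along `e₂`.
[cite: MoeglinVignerasWaldspurger1987, Chap. 2 II.1 Rem. (6), II.6] -/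
theorem leviEquivSB_kd_boxSB (b : GL (Fin n) (v.adicCompletion F)) (φ₁ φ₂ : SchwartzBruhat (Fin n → v.adicCompletion F)) :
    leviEquivSB (glEquiv (UnitaryGroup.reindexGL (e₂ n) (UnitaryGroup.blockDiagGL (b, b))))
        (continuous_linearEquiv F v _) (continuous_linearEquiv F v _) (boxSB (v.adicCompletion F) (e₂ n) φ₁ φ₂) =
      boxSB (v.adicCompletion F) (e₂ n) (leviEquivSB (glEquiv b) (continuous_linearEquiv F v _) (continuous_linearEquiv F v _) φ₁)
        (leviEquivSB (glEquiv b) (continuous_linearEquiv F v _) (continuous_linearEquiv F v _) φ₂) := by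
  apply Subtype.ext
  funext u
  rw [coe_leviEquivSB, leviOp_apply, coe_boxSB, coe_boxSB]
  dsimp only
  rw [coe_leviEquivSB, coe_leviEquivSB, leviOp_apply, leviOp_apply, glEquiv_symm_apply, glEquiv_symm_apply, glEquiv_symm_apply, ← map_inv, ← map_inv,
    Prod.inv_mk, UnitaryGroup.coe_reindexGL, UnitaryGroup.coe_blockDiagGL]
  have h := halves_reindex_fromBlocks_mulVec' F v n ((b⁻¹ : GL (Fin n) (v.adicCompletion F)) : Matrix (Fin n) (Fin n) (v.adicCompletion F)) u
  rw [show resL (e₂ n) (Matrix.reindex (e₂ n) (e₂ n) (Matrix.fromBlocks (↑b⁻¹ : Matrix (Fin n) (Fin n) (v.adicCompletion F)) 0 0 ↑b⁻¹) *ᵥ u) =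
      halfL F v n _ from rfl, h.1,
    show resR (e₂ n) (Matrix.reindex (e₂ n) (e₂ n) (Matrix.fromBlocks (↑b⁻¹ : Matrix (Fin n) (Fin n) (v.adicCompletion F)) 0 0 ↑b⁻¹) *ᵥ u) =
      halfR F v n _ from rfl, h.2]
  rfl


/-- `L_b (L_{b⁻¹} Φ) = Φ`. [cite: Weil1964, n° 13 p. 160] -/
theorem leviEquivSB_glEquiv_apply_inv {N : ℕ} (b : GL (Fin N) (v.adicCompletion F)) (Φ : SchwartzBruhat (Fin N → v.adicCompletion F)) :
    leviEquivSB (glEquiv b) (continuous_linearEquiv F v (glEquiv b)) (continuous_linearEquiv F v (glEquiv b).symm)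
        (leviEquivSB (glEquiv b⁻¹) (continuous_linearEquiv F v (glEquiv b⁻¹)) (continuous_linearEquiv F v (glEquiv b⁻¹).symm) Φ) = Φ := by
  rw [← leviEquivSB_glEquiv_symm, LinearEquiv.apply_symm_apply]

end Levi


/-- coercion of `GeneralLinearGroup.map` (definitional). [folklore] -/
private theorem coe_glMap'' {R S : Type*} [CommRing R] [CommRing S] {l : Type*} [Fintype l] [DecidableEq l] (f : R →+* S) (g : GL l R) :
    ((Matrix.GeneralLinearGroup.map f g : GL l S) : Matrix l l S) = (g : Matrix l l R).map f := rfl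

/-- the doubled `F_v`-matrix of `k₀`: `(k₀ ⊕ k₀)_v = k₀,v ⊕ k₀,v` in `GL_{n+n}(F_v)`. [folklore] -/
private theorem map_reindexGL_blockDiagGL {F : Type} [Field F] {K : Type} [Field K] (f : F →+* K) (n : ℕ) (k₀ : GL (Fin n) F) :
    Matrix.GeneralLinearGroup.map f (UnitaryGroup.reindexGL (e₂ n) (UnitaryGroup.blockDiagGL (k₀, k₀))) =
      UnitaryGroup.reindexGL (e₂ n) (UnitaryGroup.blockDiagGL (Matrix.GeneralLinearGroup.map f k₀, Matrix.GeneralLinearGroup.map f k₀)) := by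
  refine Units.ext ?_
  rw [coe_glMap'', UnitaryGroup.coe_reindexGL, UnitaryGroup.coe_reindexGL, UnitaryGroup.coe_blockDiagGL, UnitaryGroup.coe_blockDiagGL, Matrix.reindex_apply,
    Matrix.reindex_apply, ← Matrix.submatrix_map, Matrix.fromBlocks_map, Matrix.map_zero _ (map_zero f), coe_glMap'']

/-! ## §1b The Levi data of the rational similitude over `F_v` -/

section LeviData

variable (F : Type) [Field F] [NumberField F] (E : Type) [Field E] [NumberField E] [Algebra F E] [Algebra.IsQuadraticExtension F E]
  (c : E ≃ₐ[F] E) (v : HeightOneSpectrum (𝓞 F)) (n : ℕ)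
  {δ : E} (hcδ : c δ = -δ) (hδ : δ ≠ 0) {d : F} (hd : δ * δ = algebraMap F E d)
  {T₀ : Matrix (Fin n) (Fin n) F} (m₀ : Fˣ) (k₀ : GL (Fin n) F)
  (hk₀ : ((k₀ : Matrix (Fin n) (Fin n) F))ᵀ * T₀ * (k₀ : Matrix (Fin n) (Fin n) F) = (m₀ : F) • T₀)
  {KD : GL (Fin (n + n)) E}
  (hKD : KD = Matrix.GeneralLinearGroup.map (algebraMap F E) (UnitaryGroup.reindexGL (e₂ n) (UnitaryGroup.blockDiagGL (k₀, k₀))))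

omit [Algebra.IsQuadraticExtension F E] in
/-- the matrix of `(k₀ ⊕ k₀)_v` is the base change of that of `k₀ ⊕ k₀`. [cite: PlatonovRapinchuk1994, §5.1] -/
theorem coe_kdv :
    ((UnitaryGroup.reindexGL (e₂ n) (UnitaryGroup.blockDiagGL
        (Matrix.GeneralLinearGroup.map (algebraMap F (v.adicCompletion F)) k₀, Matrix.GeneralLinearGroup.map (algebraMap F (v.adicCompletion F)) k₀)) :
        GL (Fin (n + n)) (v.adicCompletion F)) : Matrix (Fin (n + n)) (Fin (n + n)) (v.adicCompletion F)) =
      (((UnitaryGroup.reindexGL (e₂ n) (UnitaryGroup.blockDiagGL (k₀, k₀))) : GL (Fin (n + n)) F) : Matrix (Fin (n + n)) (Fin (n + n)) F).map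
        (algebraMap F (v.adicCompletion F)) := by
  rw [← map_reindexGL_blockDiagGL, coe_glMap'']

omit [Algebra.IsQuadraticExtension F E] in
include hk₀ in
/-- **`ᵗ(k₀ ⊕ k₀)_v 𝕋^𝔻_v (k₀ ⊕ k₀)_v = m₀ 𝕋^𝔻_v`** over `F_v`. [cite: MoeglinVignerasWaldspurger1987, Chap. 1 I.17] -/
theorem kdv_similitude :
    (((UnitaryGroup.reindexGL (e₂ n) (UnitaryGroup.blockDiagGL
        (Matrix.GeneralLinearGroup.map (algebraMap F (v.adicCompletion F)) k₀, Matrix.GeneralLinearGroup.map (algebraMap F (v.adicCompletion F)) k₀)) :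
        GL (Fin (n + n)) (v.adicCompletion F)) : Matrix (Fin (n + n)) (Fin (n + n)) (v.adicCompletion F)))ᵀ *
        localGram F (n + n) (gramD F n T₀) v *
        ((UnitaryGroup.reindexGL (e₂ n) (UnitaryGroup.blockDiagGL
          (Matrix.GeneralLinearGroup.map (algebraMap F (v.adicCompletion F)) k₀, Matrix.GeneralLinearGroup.map (algebraMap F (v.adicCompletion F)) k₀)) :
          GL (Fin (n + n)) (v.adicCompletion F)) : Matrix (Fin (n + n)) (Fin (n + n)) (v.adicCompletion F)) =
      (unitAt F m₀ v : v.adicCompletion F) • localGram F (n + n) (gramD F n T₀) v := by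
  rw [coe_kdv F v n k₀, localGram, ← Matrix.transpose_map, ← Matrix.map_mul, ← Matrix.map_mul, transpose_kd_mul_gramD_mul_kd F n k₀ (m₀ : F) hk₀,
    Matrix.map_smul' _ _ _ (map_mul _)]
  rfl

omit [Algebra.IsQuadraticExtension F E] in
include hk₀ in
/-- **the Levi compatibility `β(K x, m₀⁻¹ K y) = β(x, y)`** for `K = (k₀ ⊕ k₀)_v` and `β = β_{T^𝔻}`. [cite: MoeglinVignerasWaldspurger1987, Chap. 2 II.6] -/
theorem localPairing_glEquiv_kdv (x y : Fin (n + n) → v.adicCompletion F) :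
    localPairing F (n + n) (gramD F n T₀) v
        (glEquiv (UnitaryGroup.reindexGL (e₂ n) (UnitaryGroup.blockDiagGL
          (Matrix.GeneralLinearGroup.map (algebraMap F (v.adicCompletion F)) k₀, Matrix.GeneralLinearGroup.map (algebraMap F (v.adicCompletion F)) k₀))) x)
        ((glEquiv (UnitaryGroup.reindexGL (e₂ n) (UnitaryGroup.blockDiagGL
          (Matrix.GeneralLinearGroup.map (algebraMap F (v.adicCompletion F)) k₀, Matrix.GeneralLinearGroup.map (algebraMap F (v.adicCompletion F)) k₀))) ≪≫ₗ
          LinearEquiv.smulOfUnit (unitAt F m₀ v)⁻¹) y) =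
      localPairing F (n + n) (gramD F n T₀) v x y := by
  rw [LinearEquiv.trans_apply, glEquiv_apply, glEquiv_apply]
  change localPairing F (n + n) (gramD F n T₀) v _ (((unitAt F m₀ v)⁻¹ : (v.adicCompletion F)ˣ) • (_ : Fin (n + n) → v.adicCompletion F)) = _
  rw [Units.smul_def, map_smul, smul_eq_mul, localPairing, Matrix.toLinearMap₂'_apply', Matrix.toLinearMap₂'_apply']
  simp only [Matrix.dotProduct_mulVec, Matrix.vecMul_vecMul]
  rw [← Matrix.vecMul_transpose, Matrix.vecMul_vecMul, ← Matrix.mul_assoc, kdv_similitude F v n m₀ k₀ hk₀, Matrix.vecMul_smul, smul_dotProduct,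
    smul_eq_mul, ← mul_assoc, Units.inv_mul, one_mul]

include hKD in
/-- **the Levi element `m(K, m₀⁻¹K)` IS the see-saw element `P = Res(KD_v) ∘ e′_{m₀}⁻¹` of ★ P3b.** [cite: Kudla1984, §1]
[cite: MoeglinVignerasWaldspurger1987, Chap. 2 II.6] -/
theorem coe_leviSp_kdv
    (had : ∀ x y : Fin (n + n) → v.adicCompletion F, localPairing F (n + n) (gramD F n T₀) v
        (glEquiv (UnitaryGroup.reindexGL (e₂ n) (UnitaryGroup.blockDiagGL
          (Matrix.GeneralLinearGroup.map (algebraMap F (v.adicCompletion F)) k₀, Matrix.GeneralLinearGroup.map (algebraMap F (v.adicCompletion F)) k₀))) x)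
        ((glEquiv (UnitaryGroup.reindexGL (e₂ n) (UnitaryGroup.blockDiagGL
          (Matrix.GeneralLinearGroup.map (algebraMap F (v.adicCompletion F)) k₀, Matrix.GeneralLinearGroup.map (algebraMap F (v.adicCompletion F)) k₀))) ≪≫ₗ
          LinearEquiv.smulOfUnit (unitAt F m₀ v)⁻¹) y) =
      localPairing F (n + n) (gramD F n T₀) v x y) :
    ((leviSp (localPairing F (n + n) (gramD F n T₀) v) _ _ had : LocalSp F (n + n) (gramD F n T₀) v) :
        ((Fin (n + n) → v.adicCompletion F) × (Fin (n + n) → v.adicCompletion F)) ≃ₗ[v.adicCompletion F]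
          ((Fin (n + n) → v.adicCompletion F) × (Fin (n + n) → v.adicCompletion F))) =
      (lineScale (unitAt F m₀ v)).symm ≪≫ₗ (isQuadraticCoordinates_local E v c hcδ hδ hd).resAut (Fin (n + n)) (toLocalGL E v KD) := by
  refine LinearEquiv.ext fun w => ?_
  obtain ⟨x, y⟩ := w
  simp only [coe_leviSp_apply, LinearEquiv.trans_apply, lineScale_symm_apply, glEquiv_apply]
  rw [resAut_toLocalGL_kd F E c v n hcδ hδ hd k₀ hKD, coe_kdv F v n k₀, UnitaryGroup.coe_reindexGL, UnitaryGroup.coe_blockDiagGL, Matrix.reindex_apply,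
    Matrix.reindex_apply, ← Matrix.submatrix_map, Matrix.fromBlocks_map, Matrix.map_zero _ (map_zero _)]
  change (_, (((unitAt F m₀ v)⁻¹ : (v.adicCompletion F)ˣ) • (_ : Fin (n + n) → v.adicCompletion F))) = _
  rw [Units.smul_def, ← Matrix.mulVec_smul]

end LeviData

/-! ## §2 The undoubled CM splitting under `Ad(k)` -/

section CM

variable (L : Type) [Field L] [NumberField L] [IsCMField L] (v : HeightOneSpectrum (𝓞 (maximalRealSubfield L)))
  [MeasurableSpace (v.adicCompletion (maximalRealSubfield L))] [BorelSpace (v.adicCompletion (maximalRealSubfield L))]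
  (μ : Measure (v.adicCompletion (maximalRealSubfield L))) [μ.IsAddHaarMeasure]
  (n : ℕ) {T₀ T₀' : Matrix (Fin n) (Fin n) (maximalRealSubfield L)} {J₀ J₀' : Matrix (Fin n) (Fin n) L}

set_option synthInstance.maxHeartbeats 400000 in
set_option maxHeartbeats 4000000 in
/-- **THE UNDOUBLED CM SPLITTING UNDER THE RATIONAL SIMILITUDE `Ad(k)`.**  For a diagonal invertible `T₀`, `k₀ ∈ GL_n(L⁺)` with `ᵗk₀ T₀ k₀ = m₀ T₀`, `T₀′ = m₀T₀`,
`k = k₀ ⊗ 1`, a splitting Hecke character `χ` and any mover `m` of `ℓ_Δ` onto `ℓ_Y`: for every `g ∈ U(T₀)(L⁺_v)` and `Φ ∈ 𝒮(L⁺_vⁿ)`,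
`ω(s_χ(k g k⁻¹)) Φ = L_k (ω(scaleTransportSection_{m₀}(s′_χ)(g)) (L_k⁻¹ Φ))`, where `s_χ = localSplittingCMWith … T₀ …`, `s′_χ = localSplittingCMWith … T₀′ …` and
`L_k Φ = Φ ∘ k₀⁻¹` is the Levi operator — `θ^{T₀}_χ ∘ Ad(k)` IS `θ^{T₀}_χ` read on the line `m₀`, intertwined by `L_k`.
[cite: MoeglinVignerasWaldspurger1987, Chap. 2 II.1 Rem. (6), II.6; Chap. 3 I.1–I.3] [cite: Kudla1994, §3 Thm 3.1] [cite: GelbartRogawski1991, §3.1 Prop. 3.1.1 p. 455 L1–3] -/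
theorem toRep_localSplittingCMWith_localCongr_k (hn : 0 < n)
    (t : Fin n → maximalRealSubfield L) (hT₀t : T₀ = Matrix.diagonal t) (hT₀ : T₀.IsSymm) (hT₀d : IsUnit T₀.det)
    (hT₀' : T₀'.IsSymm) (hT₀'d : IsUnit T₀'.det) (m₀ : (maximalRealSubfield L)ˣ) (hTT₀ : T₀' = (m₀ : maximalRealSubfield L) • T₀)
    (hJ₀ : J₀ = T₀.map (algebraMap (maximalRealSubfield L) L)) (hJ₀' : J₀' = T₀'.map (algebraMap (maximalRealSubfield L) L))
    (k₀ : GL (Fin n) (maximalRealSubfield L))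
    (hk₀ : ((k₀ : Matrix (Fin n) (Fin n) (maximalRealSubfield L)))ᵀ * T₀ * (k₀ : Matrix (Fin n) (Fin n) (maximalRealSubfield L)) =
      (m₀ : maximalRealSubfield L) • T₀)
    {k : GL (Fin n) L} (hk : k = Matrix.GeneralLinearGroup.map (algebraMap (maximalRealSubfield L) L) k₀)
    (hkJ : formCongr ((IsCMField.complexConj L : L ≃ₐ[maximalRealSubfield L] L) : L →+* L) k
      (((algebraMap (maximalRealSubfield L) L) (m₀ : maximalRealSubfield L))⁻¹ • J₀) = J₀)
    (χ : HeckeCharacter L) (hχ : IsSplittingChar L 1 χ)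
    (m : LocalMp (maximalRealSubfield L) (n + n) (gramD (maximalRealSubfield L) n T₀) v)
    (hm : (deltaLagrangian (maximalRealSubfield L) v n).map (toLin (maximalRealSubfield L) v (MpPsi.proj _ m)) =
      lagrangianY (maximalRealSubfield L) (n + n) v)
    (g : UnitaryGroup.localPi L (IsCMField.complexConj L) n J₀ v) (Φ : SchwartzBruhat (Fin n → v.adicCompletion (maximalRealSubfield L))) :
    MpPsi.toRep (localSchrodinger (maximalRealSubfield L) n T₀ v)
        (localSplittingCMWith L n hT₀ hT₀d hJ₀ χ hχ v μ
          (localCongr L (IsCMField.complexConj L) k (inv_ne_zero ((map_ne_zero _).2 m₀.ne_zero)) hkJ v g)) Φ =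
      leviEquivSB (glEquiv (Matrix.GeneralLinearGroup.map (algebraMap (maximalRealSubfield L) (v.adicCompletion (maximalRealSubfield L))) k₀))
          (continuous_linearEquiv (maximalRealSubfield L) v _) (continuous_linearEquiv (maximalRealSubfield L) v _)
        (MpPsi.toRep (localSchrodinger (maximalRealSubfield L) n T₀ v)
          (scaleTransportSection (maximalRealSubfield L) L (IsCMField.complexConj L) n (complexConj_imagUnit L) (imagUnit_ne_zero L)
            (imagUnit_mul_self L) T₀ T₀' hT₀ hT₀' m₀ hTT₀ hJ₀ hJ₀' v (localSplittingCMWith L n hT₀' hT₀'d hJ₀' χ hχ v μ)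
            (proj_localSplittingCMWith L n hT₀' hT₀'d hJ₀' χ hχ v μ) g)
          ((leviEquivSB (glEquiv (Matrix.GeneralLinearGroup.map (algebraMap (maximalRealSubfield L) (v.adicCompletion (maximalRealSubfield L))) k₀))
            (continuous_linearEquiv (maximalRealSubfield L) v _) (continuous_linearEquiv (maximalRealSubfield L) v _)).symm Φ)) := by
  have hm₀E : ((algebraMap (maximalRealSubfield L) L) (m₀ : maximalRealSubfield L)) ≠ 0 := (map_ne_zero _).2 m₀.ne_zero
  have hu : unitVec (maximalRealSubfield L) (Fin n) v ≠ 0 := fun h0 => by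
    have h1 : ((unitVec (maximalRealSubfield L) (Fin n) v : SchwartzBruhat (Fin n → v.adicCompletion (maximalRealSubfield L))) :
        (Fin n → v.adicCompletion (maximalRealSubfield L)) → ℂ) 0 = 1 :=
      unitVec_apply_of_mem fun i _ => (v.adicCompletionIntegers (maximalRealSubfield L)).zero_mem
    rw [h0, ZeroMemClass.coe_zero, Pi.zero_apply] at h1
    exact zero_ne_one h1
  -- the doubled similitude identity (★ P3a)
  have hKDJ := formCongr_kd (maximalRealSubfield L) L (IsCMField.complexConj L) n
    (rfl : (gramD (maximalRealSubfield L) n T₀).map (algebraMap (maximalRealSubfield L) L) = _) k₀ (m₀ : maximalRealSubfield L) hk₀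
    (rfl : Matrix.GeneralLinearGroup.map (algebraMap (maximalRealSubfield L) L) (UnitaryGroup.reindexGL (e₂ n) (UnitaryGroup.blockDiagGL (k₀, k₀))) = _)
    m₀.ne_zero
  -- the Levi data over `F_v`: `A = K₀,v` on `X`, `D = m₀⁻¹ K₀,v` on `Y`
  have hA := continuous_linearEquiv (maximalRealSubfield L) v
    (glEquiv (UnitaryGroup.reindexGL (e₂ n) (UnitaryGroup.blockDiagGL
      (Matrix.GeneralLinearGroup.map (algebraMap (maximalRealSubfield L) (v.adicCompletion (maximalRealSubfield L))) k₀,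
        Matrix.GeneralLinearGroup.map (algebraMap (maximalRealSubfield L) (v.adicCompletion (maximalRealSubfield L))) k₀))))
  have hA' := continuous_linearEquiv (maximalRealSubfield L) v
    (glEquiv (UnitaryGroup.reindexGL (e₂ n) (UnitaryGroup.blockDiagGL
      (Matrix.GeneralLinearGroup.map (algebraMap (maximalRealSubfield L) (v.adicCompletion (maximalRealSubfield L))) k₀,
        Matrix.GeneralLinearGroup.map (algebraMap (maximalRealSubfield L) (v.adicCompletion (maximalRealSubfield L))) k₀)))).symm
  have had := localPairing_glEquiv_kdv (maximalRealSubfield L) v n m₀ k₀ hk₀ (T₀ := T₀)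
  have hPsp := coe_leviSp_kdv (maximalRealSubfield L) L (IsCMField.complexConj L) v n (complexConj_imagUnit L) (imagUnit_ne_zero L) (imagUnit_mul_self L)
    m₀ k₀ (rfl : Matrix.GeneralLinearGroup.map (algebraMap (maximalRealSubfield L) L) (UnitaryGroup.reindexGL (e₂ n) (UnitaryGroup.blockDiagGL (k₀, k₀))) = _)
    had
  -- the Levi lift `P̃` (an opaque element with its defining equation, to keep the big goals first-order)
  obtain ⟨P, hPdef⟩ : ∃ P : LocalMp (maximalRealSubfield L) (n + n) (gramD (maximalRealSubfield L) n T₀) v,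
      (P : LocalSp (maximalRealSubfield L) (n + n) (gramD (maximalRealSubfield L) n T₀) v ×
          (SchwartzBruhat (Fin (n + n) → v.adicCompletion (maximalRealSubfield L)) ≃ₗ[ℂ]
            SchwartzBruhat (Fin (n + n) → v.adicCompletion (maximalRealSubfield L)))) =
        (leviSp (localPairing (maximalRealSubfield L) (n + n) (gramD (maximalRealSubfield L) n T₀) v) _ _ had, leviEquivSB _ hA hA') :=
    ⟨⟨(leviSp (localPairing (maximalRealSubfield L) (n + n) (gramD (maximalRealSubfield L) n T₀) v) _ _ had, leviEquivSB _ hA hA'),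
      levi_mem_MpPsi (localPairing (maximalRealSubfield L) (n + n) (gramD (maximalRealSubfield L) n T₀) v) (adeleAddCharAt (maximalRealSubfield L) v)
        (isLocallyConstant_of_isContinuousNontrivial (isContinuousNontrivial_adeleAddCharAt (maximalRealSubfield L) v))
        (continuous_toLinearMap₂'_left (localGram (maximalRealSubfield L) (n + n) (gramD (maximalRealSubfield L) n T₀) v)) _ _ had hA hA'⟩, rfl⟩
  have hP : MpPsi.proj _ P = leviSp (localPairing (maximalRealSubfield L) (n + n) (gramD (maximalRealSubfield L) n T₀) v) _ _ had := by
    rw [MpPsi.proj_apply, hPdef]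
  have hPrep : ∀ f, MpPsi.toRep (localSchrodinger (maximalRealSubfield L) (n + n) (gramD (maximalRealSubfield L) n T₀) v) P f = leviEquivSB _ hA hA' f :=
    fun f => by rw [MpPsi.toRep_apply, hPdef]
  have hPrep' : ∀ f, MpPsi.toRep (localSchrodinger (maximalRealSubfield L) (n + n) (gramD (maximalRealSubfield L) n T₀) v) P⁻¹ f =
      (leviEquivSB _ hA hA').symm f := fun f => by
    rw [MpPsi.toRep_apply, Subgroup.coe_inv, hPdef, Prod.inv_mk]
    rfl
  -- ★ P3c at `g ⊕ 1`
  have key := localSplittingDatumCM_localCongr_kd_eq_scaleTransportSection L v μ n hn t hT₀t hT₀ hT₀d hT₀' hT₀'d m₀ hTT₀ k₀ rfl (inv_ne_zero hm₀E) hKDJ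
    χ hχ _ hPsp P hP m hm (inlLoc (maximalRealSubfield L) L (IsCMField.complexConj L) v n hJ₀ rfl g)
  have key' : (localSplittingDatumCM L v μ n hT₀ hT₀d rfl χ hχ).localSplitting
      (localCongr L (IsCMField.complexConj L) _ (inv_ne_zero hm₀E) hKDJ v (inlLoc (maximalRealSubfield L) L (IsCMField.complexConj L) v n hJ₀ rfl g)) =
      P * scaleTransportSection (maximalRealSubfield L) L (IsCMField.complexConj L) (n + n) (complexConj_imagUnit L) (imagUnit_ne_zero L)
        (imagUnit_mul_self L) (gramD (maximalRealSubfield L) n T₀) (gramD (maximalRealSubfield L) n T₀')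
        (gramD_isSymm (maximalRealSubfield L) n hT₀) (gramD_isSymm (maximalRealSubfield L) n hT₀') m₀
        (gramD_of_eq_smul (maximalRealSubfield L) m₀ hTT₀) rfl rfl v
        (localSplittingDatumCM L v μ n hT₀' hT₀'d rfl χ hχ).localSplitting
        (localSplittingDatumCM L v μ n hT₀' hT₀'d rfl χ hχ).proj_localSplitting (inlLoc (maximalRealSubfield L) L (IsCMField.complexConj L) v n hJ₀ rfl g) * P⁻¹ := by
    rw [← key]
    simp only [mul_assoc, mul_inv_cancel, mul_one, mul_inv_cancel_left]
  -- `Ad(KD)(g ⊕ 1) = Ad(k)(g) ⊕ 1` (★ P3a)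
  rw [localCongr_kd_inlLoc (maximalRealSubfield L) L (IsCMField.complexConj L) v n hJ₀ rfl k₀ hk rfl (inv_ne_zero hm₀E) hKDJ hkJ g] at key'
  -- strip the second factor
  refine boxSB_left_cancel (v.adicCompletion (maximalRealSubfield L)) (e₂ n) hu ?_
  have hL : MpPsi.toRep (localSchrodinger (maximalRealSubfield L) (n + n) (gramD (maximalRealSubfield L) n T₀) v)
      ((localSplittingDatumCM L v μ n hT₀ hT₀d rfl χ hχ).localSplitting
        (inlLoc (maximalRealSubfield L) L (IsCMField.complexConj L) v n hJ₀ rfl (localCongr L (IsCMField.complexConj L) k (inv_ne_zero hm₀E) hkJ v g)))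
      (boxSB (v.adicCompletion (maximalRealSubfield L)) (e₂ n) Φ (unitVec (maximalRealSubfield L) (Fin n) v)) =
      boxSB (v.adicCompletion (maximalRealSubfield L)) (e₂ n) (MpPsi.toRep (localSchrodinger (maximalRealSubfield L) n T₀ v)
        (localSplittingCMWith L n hT₀ hT₀d hJ₀ χ hχ v μ (localCongr L (IsCMField.complexConj L) k (inv_ne_zero hm₀E) hkJ v g)) Φ)
        (unitVec (maximalRealSubfield L) (Fin n) v) :=
    toRep_undoubleLoc_boxSB (maximalRealSubfield L) L (IsCMField.complexConj L) v n hJ₀ rfl (complexConj_imagUnit L) (imagUnit_ne_zero L)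
      (imagUnit_mul_self L) hT₀ hT₀d (localSplittingDatumCM L v μ n hT₀ hT₀d rfl χ hχ).localSplitting
      (fun g => (localSplittingDatumCM L v μ n hT₀ hT₀d rfl χ hχ).proj_localSplitting g)
      (localCongr L (IsCMField.complexConj L) k (inv_ne_zero hm₀E) hkJ v g) Φ (unitVec (maximalRealSubfield L) (Fin n) v)
  have hR := fun f₁ f₂ => toRep_undoubleLoc_boxSB (maximalRealSubfield L) L (IsCMField.complexConj L) v n hJ₀ rfl
    (conj_lineDelta (complexConj_imagUnit L) m₀) (lineDelta_ne_zero (imagUnit_ne_zero L) m₀) (lineDelta_mul_self (imagUnit_mul_self L) m₀) hT₀ hT₀d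
    (scaleTransportSection (maximalRealSubfield L) L (IsCMField.complexConj L) (n + n) (complexConj_imagUnit L) (imagUnit_ne_zero L)
        (imagUnit_mul_self L) (gramD (maximalRealSubfield L) n T₀) (gramD (maximalRealSubfield L) n T₀')
        (gramD_isSymm (maximalRealSubfield L) n hT₀) (gramD_isSymm (maximalRealSubfield L) n hT₀') m₀
        (gramD_of_eq_smul (maximalRealSubfield L) m₀ hTT₀) rfl rfl v
        (localSplittingDatumCM L v μ n hT₀' hT₀'d rfl χ hχ).localSplitting
        (localSplittingDatumCM L v μ n hT₀' hT₀'d rfl χ hχ).proj_localSplitting)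
    (proj_scaleTransportSection (maximalRealSubfield L) L (IsCMField.complexConj L) (n + n) (complexConj_imagUnit L) (imagUnit_ne_zero L)
        (imagUnit_mul_self L) (gramD (maximalRealSubfield L) n T₀) (gramD (maximalRealSubfield L) n T₀')
        (gramD_isSymm (maximalRealSubfield L) n hT₀) (gramD_isSymm (maximalRealSubfield L) n hT₀') m₀
        (gramD_of_eq_smul (maximalRealSubfield L) m₀ hTT₀) rfl rfl v
        (localSplittingDatumCM L v μ n hT₀' hT₀'d rfl χ hχ).localSplitting
        (localSplittingDatumCM L v μ n hT₀' hT₀'d rfl χ hχ).proj_localSplitting) g f₁ f₂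
  rw [← scaleTransportSection_localSplittingCMWith L v μ n m₀ hT₀ hT₀' hT₀d hT₀'d hTT₀ (gramD_of_eq_smul (maximalRealSubfield L) m₀ hTT₀) hJ₀ hJ₀' χ hχ] at hR
  -- small operator identities (kept out of the big goal)
  have hmul : ∀ (x y : LocalMp (maximalRealSubfield L) (n + n) (gramD (maximalRealSubfield L) n T₀) v)
      (f : SchwartzBruhat (Fin (n + n) → v.adicCompletion (maximalRealSubfield L))),
      MpPsi.toRep (localSchrodinger (maximalRealSubfield L) (n + n) (gramD (maximalRealSubfield L) n T₀) v) (x * y) f =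
        MpPsi.toRep (localSchrodinger (maximalRealSubfield L) (n + n) (gramD (maximalRealSubfield L) n T₀) v) x
          (MpPsi.toRep (localSchrodinger (maximalRealSubfield L) (n + n) (gramD (maximalRealSubfield L) n T₀) v) y f) := fun x y f => by
    rw [map_mul]; rfl
  have hKinv : (UnitaryGroup.reindexGL (e₂ n) (UnitaryGroup.blockDiagGL
      (Matrix.GeneralLinearGroup.map (algebraMap (maximalRealSubfield L) (v.adicCompletion (maximalRealSubfield L))) k₀,
        Matrix.GeneralLinearGroup.map (algebraMap (maximalRealSubfield L) (v.adicCompletion (maximalRealSubfield L))) k₀)))⁻¹ =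
      UnitaryGroup.reindexGL (e₂ n) (UnitaryGroup.blockDiagGL
        ((Matrix.GeneralLinearGroup.map (algebraMap (maximalRealSubfield L) (v.adicCompletion (maximalRealSubfield L))) k₀)⁻¹,
          (Matrix.GeneralLinearGroup.map (algebraMap (maximalRealSubfield L) (v.adicCompletion (maximalRealSubfield L))) k₀)⁻¹)) := by
    rw [← map_inv, ← map_inv, Prod.inv_mk]
  have hsymm : ∀ X Y : SchwartzBruhat (Fin n → v.adicCompletion (maximalRealSubfield L)),
      (leviEquivSB _ hA hA').symm (boxSB (v.adicCompletion (maximalRealSubfield L)) (e₂ n) X Y) =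
        boxSB (v.adicCompletion (maximalRealSubfield L)) (e₂ n)
          (leviEquivSB (glEquiv (Matrix.GeneralLinearGroup.map (algebraMap (maximalRealSubfield L) (v.adicCompletion (maximalRealSubfield L))) k₀)⁻¹)
            (continuous_linearEquiv (maximalRealSubfield L) v _) (continuous_linearEquiv (maximalRealSubfield L) v _) X)
          (leviEquivSB (glEquiv (Matrix.GeneralLinearGroup.map (algebraMap (maximalRealSubfield L) (v.adicCompletion (maximalRealSubfield L))) k₀)⁻¹)
            (continuous_linearEquiv (maximalRealSubfield L) v _) (continuous_linearEquiv (maximalRealSubfield L) v _) Y) := by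
    intro X Y
    rw [leviEquivSB_glEquiv_symm, hKinv, leviEquivSB_kd_boxSB]
  have hfwd : ∀ X Y : SchwartzBruhat (Fin n → v.adicCompletion (maximalRealSubfield L)),
      leviEquivSB _ hA hA' (boxSB (v.adicCompletion (maximalRealSubfield L)) (e₂ n) X Y) =
        boxSB (v.adicCompletion (maximalRealSubfield L)) (e₂ n)
          (leviEquivSB (glEquiv (Matrix.GeneralLinearGroup.map (algebraMap (maximalRealSubfield L) (v.adicCompletion (maximalRealSubfield L))) k₀))
            (continuous_linearEquiv (maximalRealSubfield L) v _) (continuous_linearEquiv (maximalRealSubfield L) v _) X)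
          (leviEquivSB (glEquiv (Matrix.GeneralLinearGroup.map (algebraMap (maximalRealSubfield L) (v.adicCompletion (maximalRealSubfield L))) k₀))
            (continuous_linearEquiv (maximalRealSubfield L) v _) (continuous_linearEquiv (maximalRealSubfield L) v _) Y) :=
    fun X Y => leviEquivSB_kd_boxSB (maximalRealSubfield L) v n _ X Y
  have hΦ : leviEquivSB (glEquiv (Matrix.GeneralLinearGroup.map (algebraMap (maximalRealSubfield L) (v.adicCompletion (maximalRealSubfield L))) k₀)⁻¹)
        (continuous_linearEquiv (maximalRealSubfield L) v _) (continuous_linearEquiv (maximalRealSubfield L) v _) Φ =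
      (leviEquivSB (glEquiv (Matrix.GeneralLinearGroup.map (algebraMap (maximalRealSubfield L) (v.adicCompletion (maximalRealSubfield L))) k₀))
        (continuous_linearEquiv (maximalRealSubfield L) v _) (continuous_linearEquiv (maximalRealSubfield L) v _)).symm Φ :=
    (leviEquivSB_glEquiv_symm (maximalRealSubfield L) v _ Φ).symm
  -- assemble by a chain of exact steps (no rewriting inside the large goal)
  have e3 : MpPsi.toRep (localSchrodinger (maximalRealSubfield L) (n + n) (gramD (maximalRealSubfield L) n T₀) v) P⁻¹
      (boxSB (v.adicCompletion (maximalRealSubfield L)) (e₂ n) Φ (unitVec (maximalRealSubfield L) (Fin n) v)) =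
      boxSB (v.adicCompletion (maximalRealSubfield L)) (e₂ n)
        (leviEquivSB (glEquiv (Matrix.GeneralLinearGroup.map (algebraMap (maximalRealSubfield L) (v.adicCompletion (maximalRealSubfield L))) k₀)⁻¹)
          (continuous_linearEquiv (maximalRealSubfield L) v _) (continuous_linearEquiv (maximalRealSubfield L) v _) Φ)
        (leviEquivSB (glEquiv (Matrix.GeneralLinearGroup.map (algebraMap (maximalRealSubfield L) (v.adicCompletion (maximalRealSubfield L))) k₀)⁻¹)
          (continuous_linearEquiv (maximalRealSubfield L) v _) (continuous_linearEquiv (maximalRealSubfield L) v _)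
          (unitVec (maximalRealSubfield L) (Fin n) v)) := by
    rw [hPrep', hsymm]
  refine hL.symm.trans ?_
  refine (congrArg (fun x => MpPsi.toRep (localSchrodinger (maximalRealSubfield L) (n + n) (gramD (maximalRealSubfield L) n T₀) v) x
    (boxSB (v.adicCompletion (maximalRealSubfield L)) (e₂ n) Φ (unitVec (maximalRealSubfield L) (Fin n) v))) key').trans ?_
  refine (hmul _ _ _).trans ?_
  refine (congrArg _ e3).trans ?_
  refine (hmul _ _ _).trans ?_
  refine (congrArg _ (hR _ _)).trans ?_
  refine (hPrep _).trans ?_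
  refine (hfwd _ _).trans ?_
  exact congrArg₂ (boxSB (v.adicCompletion (maximalRealSubfield L)) (e₂ n)) (congrArg _ (congrArg _ hΦ))
    (leviEquivSB_glEquiv_apply_inv (maximalRealSubfield L) v _ _)

end CM


end Literature.NumberTheory.GelbartRogawski1991.UnitaryDualPair.LocalSplitting

end
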